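import Summits.HubbardSuperconductivity.HubbardSuperconductivity.Theses.AposterioriCapRg
import Literature.MathematicalPhysics.QuantumLattice.DWaveOrderParameterProofs

/-!
# Crux `AposterioriOrderCriterionR` (item `stmt-HubbardSuperconductivity-13884`): the honest core

Negative-side lemma of the standing disprover (cdisprove cycle 2; no definition is introduced).  The crux
(`Theses.AposterioriCapRg.AposterioriOrderCriterionR`) is `∃ kStar etaStar > 0, ∀ U μ h₀ (D : HubbardScaleData),
0 < h₀ → (∀ h ∈ Ioc 0 h₀, ∃ L₀, D.IsCertifiedEnclosure (hubbardScaleReportCT U μ D h) L₀) →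
D.MeetsThresholds kStar etaStar → (D.meanFieldDensity.fst : ℝ)/2 ≤ dWaveOrderParameter U μ`.

`exists_dishonest_of_not_aposterioriOrderCriterionR`: if the crux fails then for every constant `c ≤ 2` the CT
report is DISHONEST in its `m₀` coordinate — at some `(U, μ)`, source `h > 0`, volume `L + 1` and tolerance
`ε > 0`, for arbitrarily large `β`, some reported tuple has `m₀ > c · dWaveSourceDensity (L+1) U μ h + ε`.
Equivalently: pointwise-in-`h` honesty of `hubbardScaleReportCT` with a constant `c ≤ 2` proves the crux with ANY
thresholds (the thresholds are not used) — so a refutation must exhibit factor-`> 2` dishonesty UNIFORMLY in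
`h → 0⁺`, and a proof is exactly an honesty bound.  Where the tree can evaluate the report it is honest with
`c = 1` (`U = 0`; the empty-shell sub-report of `EmptyShell.lean` at every `U`).  Workfile:
`Cruxes/AposterioriOrderCriterionR/Disproof.lean` §2b.
-/

noncomputable section

namespace Summit.HubbardSuperconductivity.HubbardSuperconductivity.Theorems.AposterioriOrderCriterionR.Negative

open Literature.MathematicalPhysics.QuantumLattice Literature.Probability.LatticeModels
open Summit.HubbardSuperconductivity.HubbardSuperconductivity.Theses.AposterioriCapRg
open Filter Set

/-! ### The honest core -/

/-- **A refutation of the crux exhibits factor-`> 2` dishonesty of the CT report.**  If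
`AposterioriOrderCriterionR` fails, then for every `c ≤ 2` there are `(U, μ)`, a datum shape `D`, a source
`h > 0`, a tolerance `ε > 0` and a volume `L + 1` such that for arbitrarily large `β` some tuple reported by
`hubbardScaleReportCT U μ D h (L+1) β` has mean-field density `> c · dWaveSourceDensity (L+1) U μ h + ε`.
Proof: otherwise certification at each fixed `h ∈ (0, h₀)` gives `fst ≤ c·A_{L+1}(h) ≤ 2A_{L+1}(h)` eventually
in `L`, so `fst/2 ≤ liminf_L A_{L+1}(h)` and `le_dWaveOrderParameter_of_forall` closes the crux with thresholds
`(1, 1)` — hence with any. [folklore] -/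
theorem exists_dishonest_of_not_aposterioriOrderCriterionR (hR : ¬ AposterioriOrderCriterionR) {c : ℝ}
    (hc : c ≤ 2) :
    ∃ (U μ : ℝ) (D : HubbardScaleData) (h : ℝ), 0 < h ∧ ∃ ε : ℝ, 0 < ε ∧ ∃ L : ℕ, ∀ β₁ : ℝ, ∃ β : ℝ, β₁ ≤ β ∧
      ∃ p ∈ hubbardScaleReportCT U μ D h (L + 1) β,
        c * dWaveSourceDensity (L + 1) U μ h + ε < p.meanFieldDensity := by
  by_contra H
  push Not at H
  refine hR ⟨1, 1, one_pos, one_pos, fun U μ h₀ D hh₀ hcert _ => ?_⟩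
  refine le_dWaveOrderParameter_of_forall U μ hh₀ fun h hh => ?_
  obtain ⟨L₀, hL₀⟩ := hcert h ⟨hh.1, hh.2.le⟩
  have hev : ∀ᶠ L : ℕ in atTop, ((D.meanFieldDensity.fst : ℚ) : ℝ) / 2 ≤ dWaveSourceDensity (L + 1) U μ h := by
    filter_upwards [eventually_ge_atTop L₀] with L hL
    obtain ⟨β₀, hβ₀⟩ := hL₀ (L + 1) (hL.trans (Nat.le_succ L))
    have hA := dWaveSourceDensity_nonneg (L := L + 1) U μ hh.1.le
    have key : ∀ ε : ℝ, 0 < ε → ((D.meanFieldDensity.fst : ℚ) : ℝ) ≤ c * dWaveSourceDensity (L + 1) U μ h + ε := by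
      intro ε hε
      obtain ⟨β₁, hβ₁⟩ := H U μ D h hh.1 ε hε L
      obtain ⟨p, hp, henc⟩ := hβ₀ (max β₀ β₁) (le_max_left _ _)
      exact (henc.fst_le_meanFieldDensity).trans (hβ₁ _ (le_max_right _ _) p hp)
    have hfst : ((D.meanFieldDensity.fst : ℚ) : ℝ) ≤ c * dWaveSourceDensity (L + 1) U μ h :=
      le_of_forall_pos_lt_add fun ε hε => by linarith [key (ε / 2) (by positivity)]
    nlinarith
  exact le_liminf_of_le (isCoboundedUnder_ge_of_eventually_le _
    (Eventually.of_forall fun L => dWaveSourceDensity_le_const (L + 1) U μ h)) hev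

end Summit.HubbardSuperconductivity.HubbardSuperconductivity.Theorems.AposterioriOrderCriterionR.Negative
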